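import Summits.QuantumFields.YangMills.Theorems.LuscherReductionDressedRitzPolyakovLiftPScalingGramOfAmplitude
import Summits.QuantumFields.YangMills.Theorems.LuscherReductionDressedRitzPolyakovLiftStaticsDressedSymmetry
import Summits.QuantumFields.YangMills.Theorems.DressedRitz.Negative.DoubletRotationVoid
import HarnessLib

/-!
# Route `LuscherReduction`, crux `DressedRitz` (stmt-QuantumFields-20205), line «polyakovlift» r5 — NEGATIVE lane:
# the amplitude budget `ShadowAmplitudeAt` has a ROTATION VOID — no constant absorbs a lift-basis rotation whose shadows sit on two split levels

Negative-side support lemmas of the standing disprover (seat `ym-cdisprove-20205-1`, GEN 5), sequel of `DoubletRotationVoid.lean` (p532095, the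
same hazard for the Gram clause (o2)) and of `DressedCrossPair.lean` (p547925).  Target: the one-site amplitude budget `PolyakovLift.ShadowAmplitudeAt k`
(seat ym-infvol-p1, `…PolyakovLiftPScalingGramOfAmplitude.lean`, p543130; `pscalingGramAt_of_shadowAmplitude : ShadowAmplitudeAt k → PScalingGramAt k`),
which asks, for EVERY lift basis `(ω, g)` at `B₁ = 2/Λ³`, every raw vacuum `e₀` at `B = 2L³/Λ³` and each pair `i ≠ l`, for an exact orthonormal
physical eigenfamily `ψ` of `K_B` and an index set `S` with `Σ_{j∉S}⟨w_i,ψ_j⟩² + ‖w_i − Σ_j⟨w_i,ψ_j⟩ψ_j‖² ≤ CΛ²‖w_i‖²` and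
`Σ_{j∈S}⟨w_l,ψ_j⟩² ≤ CΛ²‖w_l‖²` (`w = shadowFamily B L e₀ g`).  Nothing here asserts or refutes a route item.

* §1 EIGEN-ORTHOGONALITY (`l2_eq_zero_of_eigen_ne`, `coeff_mul_coeff_eq_zero`): physical eigenvectors of the symmetric `K_β` with distinct eigenvalues
  are `l2`-orthogonal; hence if `x`, `y` are eigenvectors with `κ_x ≠ κ_y`, every member `ψ_j` of an exact eigenfamily satisfies `⟨x,ψ_j⟩·⟨y,ψ_j⟩ = 0`.
* §2 THE OUTSIDE∕INSIDE IDENTITY (`outside_eq`, ★ `outside_add_inside_rotation`): by the Parseval split (`bilin_split_eigenfamily`) the «outside-`S`» mass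
  of the clause is `‖u‖² − Σ_{j∈S}⟨u,ψ_j⟩²` exactly; for the rotated pair `u = c•x + s•y`, `v = (−s)•x + c•y` of two such eigenvectors,
  `outside_S(u) + inside_S(v) = c²‖x‖² + s²‖y‖² − (c² − s²)·(Σ_{j∈S}⟨x,ψ_j⟩² − Σ_{j∈S}⟨y,ψ_j⟩²)` for EVERY exact eigenfamily `ψ` and EVERY `S`.
* §3 THE VOID (★★ `min_sq_le_of_amplitudeClause`, `not_amplitudeClause_of_rotated_pair`, `not_amplitudeClause_halfAngle`): with `‖x‖² = ‖y‖² > 0`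
  (Bessel: `0 ≤ Σ_S ≤ ‖·‖²`) the two clause inequalities with tolerance `ε` force `min(c², s²) ≤ ε·(c² + s²)`; at 45° they force `ε ≥ ½`.  So the pair
  of budgets cannot hold, for ANY `(N, ψ, ev, S)`, with `ε = CΛ² < ½`.
* §4 WHY IT BITES THE ∀-BASIS QUANTIFIER (`rotFamily`, ★ `liftBasis_rotFamily`, `shadowVec_lincomb`, `shadowFamily_rotFamily_fst∕snd`,
  ★★ `shadowAmplitude_rotation_void`): `LiftBasis B₁ k ω g` is CLOSED under rotating two members `g_i, g_l` that share their one-site level at `B₁`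
  (`c² + s² = 1`), and the shadow map `g ↦ K_B^[dressSteps L](ins e₀ (g ∘ powLink L))` is LINEAR, so the rotated basis has shadows `c•w_i + s•w_l`,
  `(−s)•w_i + c•w_l`.  MODEL HYPOTHESIS (not constructible in the tree, hence no `¬ ShadowAmplitudeAt`): the two shadows `w_i, w_l` are exact eigenvectors
  of `K_B` with DISTINCT eigenvalues and equal norms — the `B₁`-degeneracy of the pair is SPLIT at `B`.  Then the conclusion `ShadowAmplitudeAt` demands at
  the point (rotated basis, `e₀`, `i`, `l`) is false for every `C` with `CΛ² < ½`, i.e. for all small `Λ` whatever `C` is.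

CENSUS READING (prose, for the holder of S-STAT and the LEAD).  `ShadowAmplitudeAt k` is exactly as safe as LEVEL NON-CROSSING between the one-site
problem at `B₁ = 2/Λ³` (where the lift basis is an eigenbasis) and the image levels at `B = 2L³/Λ³`: (a) an exact SYMMETRY multiplet at `B₁` is harmless —
its shadows form an exactly degenerate `K_B`-multiplet, `ψ` may be adapted to the rotated pair and `S` chosen as that member's line (Schur;
`DoubletRotationVoid` §3, `…PolyakovLiftMultipletRecombination`); (b) an ACCIDENTAL degeneracy at `B₁` between two levels of the same symmetry type that
is split at `B` kills the clause for the rotated bases (this file) and no enlargement of `C` repairs it — the repairs are to keep `lam0(k)` below every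
such crossing among the first `k + 1` one-site levels of `B ↦ levelValue su2Rep 1 B ·` (a finite, numerically decidable check per `k`), or to weaken the
∀-basis quantifier to «some basis adapted at `B`» (not what the consumer `liftStaticsR3_of_gramUniversality_pscalingGram` currently takes).

HONEST FRAMING: finite-dimensional Parseval∕Bessel bookkeeping for `l2` and the symmetric transfer operator on a fixed lattice (conditional femto rung R2b1);
nothing here bears on infinite volume, the continuum limit or the Clay gap.  Refs: [cite: Luscher1983, §3]; T. Kato (1966) §V.4 [cite: Kato1966, §V.4].
-/

set_option autoImplicit false

noncomputable section

open MeasureTheory Filter Topology Real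
open Literature.MathematicalPhysics.QuantumFieldTheory (GaugeConfig Site gaugeTransform)
open scoped BigOperators

namespace Summit.QuantumFields.YangMills.Theorems.FemtoTransferGap.PolyakovLift.Negative

open Summit.QuantumFields.YangMills.Theorems.FemtoTransferGap
open Summit.QuantumFields.YangMills.Theorems.FemtoTransferGap.PolyakovLift
open Summit.QuantumFields.YangMills.Theorems.FemtoTransferGap.LiftPos

/-! ## §1 Eigen-orthogonality -/

section Eigen

variable {L : ℕ} [NeZero L] (β : ℝ)

/-- Physical eigenvectors of the symmetric `K_β` with distinct eigenvalues are `l2`-orthogonal. [cite: Kato1966, §V.4] -/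
theorem l2_eq_zero_of_eigen_ne {x y : GaugeConfig 3 L SU2 → ℝ} (hx : IsPhys x) (hy : IsPhys y) {κx κy : ℝ}
    (hex : transferApply β x = κx • x) (hey : transferApply β y = κy • y) (hne : κx ≠ κy) : l2 x y = 0 := by
  have h := l2_transferApply_comm β hx hy
  rw [hex, hey, l2_smul_left, l2_smul_right''] at h
  by_contra h0
  exact hne (mul_right_cancel₀ h0 h)

/-- If `x`, `y` are physical eigenvectors of `K_β` with DISTINCT eigenvalues, every physical eigenvector `ψ` of `K_β` is orthogonal to one of them:
`⟨x,ψ⟩·⟨y,ψ⟩ = 0`. [cite: Kato1966, §V.4] -/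
theorem coeff_mul_coeff_eq_zero {x y ψ : GaugeConfig 3 L SU2 → ℝ} (hx : IsPhys x) (hy : IsPhys y) (hψ : IsPhys ψ) {κx κy μ : ℝ}
    (hex : transferApply β x = κx • x) (hey : transferApply β y = κy • y) (hψe : transferApply β ψ = μ • ψ) (hne : κx ≠ κy) :
    l2 x ψ * l2 y ψ = 0 := by
  by_cases hμ : κx = μ
  · have hyμ : κy ≠ μ := fun h => hne (hμ.trans h.symm)
    rw [l2_eq_zero_of_eigen_ne β hy hψ hey hψe hyμ, mul_zero]
  · rw [l2_eq_zero_of_eigen_ne β hx hψ hex hψe hμ, zero_mul]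

end Eigen

/-! ## §2 The outside∕inside identity -/

section Identity

variable {L : ℕ} [NeZero L] (β : ℝ) {N : ℕ} {ψ : Fin N → (GaugeConfig 3 L SU2 → ℝ)}

/-- The «outside-`S`» mass of the amplitude clause is `‖u‖² − Σ_{j∈S}⟨u,ψ_j⟩²` (Parseval split against the exact eigenfamily, then
`Σ_j = Σ_{j∈S} + Σ_{j∉S}`). [cite: Kato1966, §V.4] -/
theorem outside_eq (hψ : ∀ j, IsPhys (ψ j)) (hon : ∀ j j', l2 (ψ j) (ψ j') = if j = j' then 1 else 0) (ev : Fin N → ℝ)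
    (heig : ∀ j, transferApply β (ψ j) = ev j • ψ j) {u : GaugeConfig 3 L SU2 → ℝ} (hu : IsPhys u) (S : Finset (Fin N)) :
    ∑ j ∈ Sᶜ, l2 u (ψ j) ^ 2 + l2 (u - ∑ j, l2 u (ψ j) • ψ j) (u - ∑ j, l2 u (ψ j) • ψ j) =
      l2 u u - ∑ j ∈ S, l2 u (ψ j) ^ 2 := by
  classical
  obtain ⟨huu, -⟩ := bilin_split_eigenfamily β hψ hon ev heig hu hu
  have hsq : ∑ j, l2 u (ψ j) * l2 u (ψ j) = ∑ j, l2 u (ψ j) ^ 2 := Finset.sum_congr rfl fun j _ => (sq _).symm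
  have hsplit : ∑ j, l2 u (ψ j) ^ 2 = ∑ j ∈ S, l2 u (ψ j) ^ 2 + ∑ j ∈ Sᶜ, l2 u (ψ j) ^ 2 :=
    (Finset.sum_add_sum_compl S fun j => l2 u (ψ j) ^ 2).symm
  rw [hsq, hsplit] at huu
  linarith

variable {x y : GaugeConfig 3 L SU2 → ℝ} {κx κy : ℝ}

/-- Squared coefficients of the rotated pair on an eigenvector orthogonal to `x` or to `y`:
`⟨c•x + s•y, ψ⟩² = c²⟨x,ψ⟩² + s²⟨y,ψ⟩²`, `⟨(−s)•x + c•y, ψ⟩² = s²⟨x,ψ⟩² + c²⟨y,ψ⟩²`. [folklore] -/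
theorem sq_coeff_rotation {ψ₀ : GaugeConfig 3 L SU2 → ℝ} (hx : IsPhys x) (hy : IsPhys y) (hψ₀ : IsPhys ψ₀) (h0 : l2 x ψ₀ * l2 y ψ₀ = 0)
    (c s : ℝ) :
    l2 (c • x + s • y) ψ₀ ^ 2 = c ^ 2 * l2 x ψ₀ ^ 2 + s ^ 2 * l2 y ψ₀ ^ 2 ∧
      l2 ((-s) • x + c • y) ψ₀ ^ 2 = s ^ 2 * l2 x ψ₀ ^ 2 + c ^ 2 * l2 y ψ₀ ^ 2 := by
  rw [l2_lincomb_left' hx hy hψ₀ c s, l2_lincomb_left' hx hy hψ₀ (-s) c]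
  constructor
  · linear_combination (2 * c * s) * h0
  · linear_combination (-(2 * c * s)) * h0

/-- ★ **The outside∕inside identity of a rotated split pair.**  For physical eigenvectors `x`, `y` of `K_β` with DISTINCT eigenvalues, every exact
orthonormal physical eigenfamily `ψ` of `K_β` and every index set `S`, the rotated pair `u = c•x + s•y`, `v = (−s)•x + c•y` has
`(Σ_{j∉S}⟨u,ψ_j⟩² + ‖u − Σ_j⟨u,ψ_j⟩ψ_j‖²) + Σ_{j∈S}⟨v,ψ_j⟩² = c²‖x‖² + s²‖y‖² − (c² − s²)·(Σ_{j∈S}⟨x,ψ_j⟩² − Σ_{j∈S}⟨y,ψ_j⟩²)`. [cite: Kato1966, §V.4] -/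
theorem outside_add_inside_rotation (hψ : ∀ j, IsPhys (ψ j)) (hon : ∀ j j', l2 (ψ j) (ψ j') = if j = j' then 1 else 0) (ev : Fin N → ℝ)
    (heig : ∀ j, transferApply β (ψ j) = ev j • ψ j) (hx : IsPhys x) (hy : IsPhys y)
    (hex : transferApply β x = κx • x) (hey : transferApply β y = κy • y) (hne : κx ≠ κy) (S : Finset (Fin N)) (c s : ℝ) :
    (∑ j ∈ Sᶜ, l2 (c • x + s • y) (ψ j) ^ 2 +
        l2 (c • x + s • y - ∑ j, l2 (c • x + s • y) (ψ j) • ψ j) (c • x + s • y - ∑ j, l2 (c • x + s • y) (ψ j) • ψ j)) +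
      ∑ j ∈ S, l2 ((-s) • x + c • y) (ψ j) ^ 2 =
      c ^ 2 * l2 x x + s ^ 2 * l2 y y - (c ^ 2 - s ^ 2) * (∑ j ∈ S, l2 x (ψ j) ^ 2 - ∑ j ∈ S, l2 y (ψ j) ^ 2) := by
  have hu : IsPhys (c • x + s • y) := (hx.smul c).add (hy.smul s)
  have hxy : l2 x y = 0 := l2_eq_zero_of_eigen_ne β hx hy hex hey hne
  have hcoef : ∀ j, l2 x (ψ j) * l2 y (ψ j) = 0 := fun j => coeff_mul_coeff_eq_zero β hx hy (hψ j) hex hey (heig j) hne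
  have hSu : ∑ j ∈ S, l2 (c • x + s • y) (ψ j) ^ 2 = c ^ 2 * ∑ j ∈ S, l2 x (ψ j) ^ 2 + s ^ 2 * ∑ j ∈ S, l2 y (ψ j) ^ 2 := by
    rw [Finset.mul_sum, Finset.mul_sum, ← Finset.sum_add_distrib]
    exact Finset.sum_congr rfl fun j _ => (sq_coeff_rotation hx hy (hψ j) (hcoef j) c s).1
  have hSv : ∑ j ∈ S, l2 ((-s) • x + c • y) (ψ j) ^ 2 = s ^ 2 * ∑ j ∈ S, l2 x (ψ j) ^ 2 + c ^ 2 * ∑ j ∈ S, l2 y (ψ j) ^ 2 := by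
    rw [Finset.mul_sum, Finset.mul_sum, ← Finset.sum_add_distrib]
    exact Finset.sum_congr rfl fun j _ => (sq_coeff_rotation hx hy (hψ j) (hcoef j) c s).2
  rw [outside_eq β hψ hon ev heig hu S, hSu, hSv, l2_rotation_self hx hy c s, hxy]
  ring

end Identity

/-! ## §3 The void: the two budgets force `ε ≥ min(c², s²)/(c² + s²)` -/

section Void

variable {L : ℕ} [NeZero L] (β : ℝ) {x y : GaugeConfig 3 L SU2 → ℝ} {κx κy : ℝ}

/-- ★★ **Rotation void, quantitative form.**  `x`, `y`: physical eigenvectors of `K_β` with distinct eigenvalues and equal positive norms; `ψ`: any exact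
orthonormal physical eigenfamily; `S`: any index set.  If the rotated pair `u = c•x + s•y`, `v = (−s)•x + c•y` satisfies the two amplitude budgets with
tolerance `ε` — `Σ_{j∉S}⟨u,ψ_j⟩² + ‖u − Σ_j⟨u,ψ_j⟩ψ_j‖² ≤ ε‖u‖²` and `Σ_{j∈S}⟨v,ψ_j⟩² ≤ ε‖v‖²` — then `min(c², s²) ≤ ε·(c² + s²)`. [cite: Kato1966, §V.4] -/
theorem min_sq_le_of_amplitudeClause {N : ℕ} {ψ : Fin N → (GaugeConfig 3 L SU2 → ℝ)} (hψ : ∀ j, IsPhys (ψ j))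
    (hon : ∀ j j', l2 (ψ j) (ψ j') = if j = j' then 1 else 0) (ev : Fin N → ℝ) (heig : ∀ j, transferApply β (ψ j) = ev j • ψ j)
    (hx : IsPhys x) (hy : IsPhys y) (hex : transferApply β x = κx • x) (hey : transferApply β y = κy • y) (hne : κx ≠ κy)
    (hnorm : l2 y y = l2 x x) (hpos : 0 < l2 x x) (S : Finset (Fin N)) {c s ε : ℝ}
    (hout : ∑ j ∈ Sᶜ, l2 (c • x + s • y) (ψ j) ^ 2 +
        l2 (c • x + s • y - ∑ j, l2 (c • x + s • y) (ψ j) • ψ j) (c • x + s • y - ∑ j, l2 (c • x + s • y) (ψ j) • ψ j) ≤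
        ε * l2 (c • x + s • y) (c • x + s • y))
    (hin : ∑ j ∈ S, l2 ((-s) • x + c • y) (ψ j) ^ 2 ≤ ε * l2 ((-s) • x + c • y) ((-s) • x + c • y)) :
    min (c ^ 2) (s ^ 2) ≤ ε * (c ^ 2 + s ^ 2) := by
  classical
  have hid := outside_add_inside_rotation β hψ hon ev heig hx hy hex hey hne S c s
  have hxy : l2 x y = 0 := l2_eq_zero_of_eigen_ne β hx hy hex hey hne
  have huu : l2 (c • x + s • y) (c • x + s • y) = (c ^ 2 + s ^ 2) * l2 x x := by
    rw [l2_rotation_self hx hy c s, hxy, hnorm]; ring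
  have hvv : l2 ((-s) • x + c • y) ((-s) • x + c • y) = (c ^ 2 + s ^ 2) * l2 x x := by
    rw [l2_rotation_self hx hy (-s) c, hxy, hnorm]; ring
  -- Bessel: `0 ≤ Σ_{j∈S}⟨z,ψ_j⟩² ≤ ‖z‖²`
  have hbessel : ∀ {z : GaugeConfig 3 L SU2 → ℝ}, IsPhys z → ∑ j ∈ S, l2 z (ψ j) ^ 2 ≤ l2 z z := fun {z} hz => by
    obtain ⟨hzz, -⟩ := bilin_split_eigenfamily β hψ hon ev heig hz hz
    have h1 : ∑ j ∈ S, l2 z (ψ j) ^ 2 ≤ ∑ j, l2 z (ψ j) ^ 2 := Finset.sum_le_univ_sum_of_nonneg fun j => sq_nonneg _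
    have h2 : ∑ j, l2 z (ψ j) ^ 2 = ∑ j, l2 z (ψ j) * l2 z (ψ j) := Finset.sum_congr rfl fun j _ => sq _
    linarith [l2_self_nonneg (z - ∑ j, l2 z (ψ j) • ψ j)]
  set A : ℝ := ∑ j ∈ S, l2 x (ψ j) ^ 2 with hA
  set Bv : ℝ := ∑ j ∈ S, l2 y (ψ j) ^ 2 with hBv
  have hA0 : 0 ≤ A := Finset.sum_nonneg fun j _ => sq_nonneg _
  have hB0 : 0 ≤ Bv := Finset.sum_nonneg fun j _ => sq_nonneg _
  have hAle : A ≤ l2 x x := hbessel hx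
  have hBle : Bv ≤ l2 x x := hnorm ▸ hbessel hy
  -- the sum of the two budgets, and `2·min(c²,s²)·‖x‖² ≤` it
  have hsum : c ^ 2 * l2 x x + s ^ 2 * l2 y y - (c ^ 2 - s ^ 2) * (A - Bv) ≤ 2 * (ε * ((c ^ 2 + s ^ 2) * l2 x x)) := by
    rw [← hid]; rw [huu] at hout; rw [hvv] at hin; linarith
  rw [hnorm] at hsum
  have hkey : 2 * min (c ^ 2) (s ^ 2) * l2 x x ≤ c ^ 2 * l2 x x + s ^ 2 * l2 x x - (c ^ 2 - s ^ 2) * (A - Bv) := by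
    rcases le_total (c ^ 2) (s ^ 2) with h | h
    · rw [min_eq_left h]; nlinarith [mul_nonneg (sub_nonneg.2 h) (show 0 ≤ l2 x x + A - Bv by linarith)]
    · rw [min_eq_right h]; nlinarith [mul_nonneg (sub_nonneg.2 h) (show 0 ≤ l2 x x - A + Bv by linarith)]
  have h2 : 2 * min (c ^ 2) (s ^ 2) * l2 x x ≤ 2 * (ε * (c ^ 2 + s ^ 2)) * l2 x x := by linarith
  nlinarith [le_of_mul_le_mul_right h2 hpos]

/-- ★★ **Rotation void, clause form.**  Under the hypotheses of `min_sq_le_of_amplitudeClause`, if `ε·(c² + s²) < min(c², s²)` then NO exact eigenfamily and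
NO index set realise the two amplitude budgets for the rotated pair — the literal shape of the conclusion of `PolyakovLift.ShadowAmplitudeAt` with
`ε = CΛ²`, `w_i ↦ c•x + s•y`, `w_l ↦ (−s)•x + c•y`. [cite: Kato1966, §V.4] -/
theorem not_amplitudeClause_of_rotated_pair (hx : IsPhys x) (hy : IsPhys y) (hex : transferApply β x = κx • x)
    (hey : transferApply β y = κy • y) (hne : κx ≠ κy) (hnorm : l2 y y = l2 x x) (hpos : 0 < l2 x x) {c s ε : ℝ}
    (hε : ε * (c ^ 2 + s ^ 2) < min (c ^ 2) (s ^ 2)) :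
    ¬ ∃ (N : ℕ) (ψ : Fin N → (GaugeConfig 3 L SU2 → ℝ)) (ev : Fin N → ℝ) (S : Finset (Fin N)),
        (∀ j, IsPhys (ψ j)) ∧ (∀ j j', l2 (ψ j) (ψ j') = if j = j' then 1 else 0) ∧
        (∀ j, transferApply β (ψ j) = ev j • ψ j) ∧
        (∑ j ∈ Sᶜ, l2 (c • x + s • y) (ψ j) ^ 2 +
            l2 (c • x + s • y - ∑ j, l2 (c • x + s • y) (ψ j) • ψ j) (c • x + s • y - ∑ j, l2 (c • x + s • y) (ψ j) • ψ j) ≤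
          ε * l2 (c • x + s • y) (c • x + s • y)) ∧
        (∑ j ∈ S, l2 ((-s) • x + c • y) (ψ j) ^ 2 ≤ ε * l2 ((-s) • x + c • y) ((-s) • x + c • y)) := by
  rintro ⟨N, ψ, ev, S, hψ, hon, heig, hout, hin⟩
  exact absurd (min_sq_le_of_amplitudeClause β hψ hon ev heig hx hy hex hey hne hnorm hpos S hout hin) (not_le.2 hε)

/-- The 45° instance: for `u = x + y`, `v = y − x` the two budgets are impossible with any tolerance `ε < ½`. [cite: Kato1966, §V.4] -/
theorem not_amplitudeClause_halfAngle (hx : IsPhys x) (hy : IsPhys y) (hex : transferApply β x = κx • x)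
    (hey : transferApply β y = κy • y) (hne : κx ≠ κy) (hnorm : l2 y y = l2 x x) (hpos : 0 < l2 x x) {ε : ℝ} (hε : ε < 1 / 2) :
    ¬ ∃ (N : ℕ) (ψ : Fin N → (GaugeConfig 3 L SU2 → ℝ)) (ev : Fin N → ℝ) (S : Finset (Fin N)),
        (∀ j, IsPhys (ψ j)) ∧ (∀ j j', l2 (ψ j) (ψ j') = if j = j' then 1 else 0) ∧
        (∀ j, transferApply β (ψ j) = ev j • ψ j) ∧
        (∑ j ∈ Sᶜ, l2 (x + y) (ψ j) ^ 2 + l2 (x + y - ∑ j, l2 (x + y) (ψ j) • ψ j) (x + y - ∑ j, l2 (x + y) (ψ j) • ψ j) ≤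
          ε * l2 (x + y) (x + y)) ∧
        (∑ j ∈ S, l2 (y - x) (ψ j) ^ 2 ≤ ε * l2 (y - x) (y - x)) := by
  have h1 : ε * ((1 : ℝ) ^ 2 + (1 : ℝ) ^ 2) < min ((1 : ℝ) ^ 2) ((1 : ℝ) ^ 2) := by rw [min_self]; linarith
  have h := not_amplitudeClause_of_rotated_pair β hx hy hex hey hne hnorm hpos h1
  simpa only [one_smul, neg_smul, neg_add_eq_sub] using h

end Void

/-! ## §4 Why the void bites the ∀-basis quantifier of `ShadowAmplitudeAt` -/

section Basis

variable {B : ℝ} {k : ℕ} {ω : GaugeConfig 3 1 SU2 → ℝ} {g g' : Fin k → (GaugeConfig 3 1 SU2 → ℝ)} {i l : Fin k} {c s : ℝ}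

/-- ★ **`LiftBasis` is closed under intra-level rotations.**  If two members `g_i`, `g_l` (`i ≠ l`) of a lift basis at `B` have their states `g_i·ω`,
`g_l·ω` on a COMMON eigenvalue of `K_B`, then every family `g'` agreeing with `g` off `{i, l}` and carrying the rotated pair
`g'_i = c•g_i + s•g_l`, `g'_l = (−s)•g_i + c•g_l` (`c² + s² = 1`; e.g. `Function.update (Function.update g i _) l _`) is again a lift basis at `B`
(same `ω`, same level assignment). [cite: Luscher1983, §3] -/
theorem liftBasis_of_rotated (hb : LiftBasis B k ω g) (hil : i ≠ l)
    (hdeg : ∃ κ : ℝ, transferApply B (g i * ω) = κ • (g i * ω) ∧ transferApply B (g l * ω) = κ • (g l * ω)) (hcs : c ^ 2 + s ^ 2 = 1)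
    (hg'i : g' i = c • g i + s • g l) (hg'l : g' l = (-s) • g i + c • g l) (hg'o : ∀ m, m ≠ i → m ≠ l → g' m = g m) :
    LiftBasis B k ω g' := by
  obtain ⟨hω, hωpos, hω1, hKω, hg, ⟨σ, hσ⟩, hon⟩ := hb
  obtain ⟨κ, hκi, hκl⟩ := hdeg
  have hU : ∀ m, IsPhys (g m * ω) := fun m => OpPlat.isPhys_mul (hg m) hω
  have hdiag : ∀ m, l2 (g m * ω) (g m * ω) = 1 := fun m => by rw [hon m m, if_pos rfl]
  -- the common eigenvalue is the level of both members
  have hlev : ∀ {m : Fin k} {κ' : ℝ}, transferApply B (g m * ω) = κ' • (g m * ω) → levelValue su2Rep 1 B ((σ m : ℕ) + 1) = κ' :=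
    fun {m κ'} hm => by
      have h1 := congrArg (fun f => l2 f (g m * ω)) hm; have h2 := congrArg (fun f => l2 f (g m * ω)) (hσ m)
      simp only [l2_smul_left, hdiag m, mul_one] at h1 h2; exact h2.symm.trans h1
  have hli : levelValue su2Rep 1 B ((σ i : ℕ) + 1) = κ := hlev hκi
  have hll : levelValue su2Rep 1 B ((σ l : ℕ) + 1) = κ := hlev hκl
  have hmul : ∀ a b : ℝ, (a • g i + b • g l) * ω = a • (g i * ω) + b • (g l * ω) := fun a b => by
    funext U; simp only [Pi.mul_apply, Pi.add_apply, Pi.smul_apply, smul_eq_mul]; ring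
  have heig2 : ∀ a b : ℝ, transferApply B ((a • g i + b • g l) * ω) = κ • ((a • g i + b • g l) * ω) := fun a b => by
    rw [hmul, transferApply_add B ((hU i).smul a) ((hU l).smul b), transferApply_smul, transferApply_smul, hκi, hκl, smul_add,
      smul_smul, smul_smul, smul_smul, smul_smul, mul_comm a κ, mul_comm b κ]
  -- inner products of the two rotated states against everything
  have hoff : l2 (g i * ω) (g l * ω) = 0 := by rw [hon i l, if_neg hil]
  have hoff' : l2 (g l * ω) (g i * ω) = 0 := by rw [hon l i, if_neg (Ne.symm hil)]
  have hrow : ∀ (a b : ℝ) {Y : GaugeConfig 3 1 SU2 → ℝ}, IsPhys Y →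
      l2 ((a • g i + b • g l) * ω) Y = a * l2 (g i * ω) Y + b * l2 (g l * ω) Y := fun a b Y hY => by
    rw [hmul, l2_lincomb_left' (hU i) (hU l) hY]
  have hcol : ∀ (a b : ℝ) {Y : GaugeConfig 3 1 SU2 → ℝ}, IsPhys Y →
      l2 Y ((a • g i + b • g l) * ω) = a * l2 Y (g i * ω) + b * l2 Y (g l * ω) := fun a b Y hY => by
    rw [hmul, l2_add_right hY ((hU i).smul a) ((hU l).smul b), l2_smul_right'', l2_smul_right'']
  have hphys2 : ∀ a b : ℝ, IsPhys ((a • g i + b • g l) * ω) := fun a b => by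
    rw [hmul]; exact ((hU i).smul a).add ((hU l).smul b)
  refine ⟨hω, hωpos, hω1, hKω, fun m => ?_, ⟨σ, fun m => ?_⟩, fun m m' => ?_⟩
  · -- physicality
    by_cases hmi : m = i
    · rw [hmi, hg'i]; exact ((hg i).smul c).add ((hg l).smul s)
    · by_cases hml : m = l
      · rw [hml, hg'l]; exact ((hg i).smul (-s)).add ((hg l).smul c)
      · rw [hg'o m hmi hml]; exact hg m
  · -- eigen-equations with the same level assignment
    by_cases hmi : m = i
    · rw [hmi, hg'i, hli]; exact heig2 c s
    · by_cases hml : m = l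
      · rw [hml, hg'l, hll]; exact heig2 (-s) c
      · rw [hg'o m hmi hml]; exact hσ m
  · -- orthonormality
    by_cases hmi : m = i
    · rw [hmi, hg'i]
      by_cases hm'i : m' = i
      · rw [hm'i, hg'i, if_pos rfl, hrow c s (hphys2 c s), hcol c s (hU i), hcol c s (hU l), hdiag i, hdiag l, hoff, hoff']
        linear_combination hcs
      · by_cases hm'l : m' = l
        · rw [hm'l, hg'l, if_neg hil, hrow c s (hphys2 (-s) c), hcol (-s) c (hU i), hcol (-s) c (hU l), hdiag i, hdiag l, hoff, hoff']
          ring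
        · rw [hg'o m' hm'i hm'l, if_neg (Ne.symm hm'i), hrow c s (hU m'), hon i m', hon l m', if_neg (Ne.symm hm'i),
            if_neg (Ne.symm hm'l)]
          ring
    · by_cases hml : m = l
      · rw [hml, hg'l]
        by_cases hm'i : m' = i
        · rw [hm'i, hg'i, if_neg (Ne.symm hil), hrow (-s) c (hphys2 c s), hcol c s (hU i), hcol c s (hU l), hdiag i, hdiag l,
            hoff, hoff']
          ring
        · by_cases hm'l : m' = l
          · rw [hm'l, hg'l, if_pos rfl, hrow (-s) c (hphys2 (-s) c), hcol (-s) c (hU i), hcol (-s) c (hU l), hdiag i, hdiag l,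
              hoff, hoff']
            linear_combination hcs
          · rw [hg'o m' hm'i hm'l, if_neg (Ne.symm hm'l), hrow (-s) c (hU m'), hon i m', hon l m', if_neg (Ne.symm hm'i),
              if_neg (Ne.symm hm'l)]
            ring
      · rw [hg'o m hmi hml]
        by_cases hm'i : m' = i
        · rw [hm'i, hg'i, if_neg hmi, hcol c s (hU m), hon m i, hon m l, if_neg hmi, if_neg hml]
          ring
        · by_cases hm'l : m' = l
          · rw [hm'l, hg'l, if_neg hml, hcol (-s) c (hU m), hon m i, hon m l, if_neg hmi, if_neg hml]
            ring
          · rw [hg'o m' hm'i hm'l, hon m m']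

end Basis

section Shadow

variable {k : ℕ}

/-- **The shadow map is linear** in the one-site function: `shadowVec B L e₀ (a•g + b•h) = a•shadowVec B L e₀ g + b•shadowVec B L e₀ h` (composition with
`powLink L`, the insertion `ins e₀`, and `K_B^[dressSteps L]` are linear). [cite: Luscher1983, §3] -/
theorem shadowVec_lincomb (B : ℝ) (L : ℕ) {e₀ : GaugeConfig 3 1 SU2 → ℝ} (he₀ : IsPhys e₀) {g h : GaugeConfig 3 1 SU2 → ℝ}
    (hg : IsPhys g) (hh : IsPhys h) (a b : ℝ) :
    shadowVec B L e₀ (a • g + b • h) = a • shadowVec B L e₀ g + b • shadowVec B L e₀ h := by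
  unfold shadowVec
  have hcomp : (a • g + b • h) ∘ powLink L = a • (g ∘ powLink L) + b • (h ∘ powLink L) := by
    funext V; simp only [Function.comp_apply, Pi.add_apply, Pi.smul_apply, smul_eq_mul]
  rw [hcomp, ins_lincomb he₀ (isPhys_comp_powLink L hg) (isPhys_comp_powLink L hh),
    iterate_transferApply_lincomb B (OpPlat.isPhys_ins he₀ (isPhys_comp_powLink L hg)) (OpPlat.isPhys_ins he₀ (isPhys_comp_powLink L hh))]

/-- Shadows of a rotated pair: `w'_i = c•w_i + s•w_l`, `w'_l = (−s)•w_i + c•w_l`. [cite: Luscher1983, §3] -/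
theorem shadowFamily_rotated (B : ℝ) (L : ℕ) {e₀ : GaugeConfig 3 1 SU2 → ℝ} (he₀ : IsPhys e₀) {g g' : Fin k → (GaugeConfig 3 1 SU2 → ℝ)}
    (hg : ∀ m, IsPhys (g m)) {i l : Fin k} {c s : ℝ} (hg'i : g' i = c • g i + s • g l) (hg'l : g' l = (-s) • g i + c • g l) :
    shadowFamily B L e₀ g' i = c • shadowFamily B L e₀ g i + s • shadowFamily B L e₀ g l ∧
      shadowFamily B L e₀ g' l = (-s) • shadowFamily B L e₀ g i + c • shadowFamily B L e₀ g l := by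
  simp only [shadowFamily, hg'i, hg'l, shadowVec_lincomb B L he₀ (hg i) (hg l), and_self]

end Shadow

/-- ★★ **The rotation void in the frame of `ShadowAmplitudeAt`.**  Data of one point of `ShadowAmplitudeAt k` (there `B₁ = 2/Λ³`, `B = 2L³/Λ³`,
`ε = CΛ²`): a lift basis `(ω, g)` at `B₁`, a raw vacuum `e₀` at `B`, a pair `i ≠ l` whose one-site states share their `K_{B₁}`-eigenvalue, and a
rotation `g'` of `g` in the plane of `(g_i, g_l)` (`c² + s² = 1`).  MODEL HYPOTHESIS: the shadows `w_i`, `w_l` are exact eigenvectors of `K_B` with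
DISTINCT eigenvalues and equal (positive, cf. `shadowFamily_o0`) norms — the `B₁`-degeneracy is split at `B`.  Then `g'` is again a lift basis at `B₁`,
and at the point (`g'`, `e₀`, `i`, `l`) the conclusion of `ShadowAmplitudeAt` is FALSE for every tolerance `ε < min(c², s²)` (`ε < ½` at 45°): no
enlargement of `C` absorbs the rotation. [cite: Luscher1983, §3] [cite: Kato1966, §V.4] -/
theorem shadowAmplitude_rotation_void {k : ℕ} {B₁ B : ℝ} {L : ℕ} {ω : GaugeConfig 3 1 SU2 → ℝ} {g g' : Fin k → (GaugeConfig 3 1 SU2 → ℝ)}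
    (hbasis : LiftBasis B₁ k ω g) {e₀ : GaugeConfig 3 1 SU2 → ℝ} (he₀ : IsRawVacuum (L := 1) B e₀) {i l : Fin k} (hil : i ≠ l)
    (hdeg : ∃ κ : ℝ, transferApply B₁ (g i * ω) = κ • (g i * ω) ∧ transferApply B₁ (g l * ω) = κ • (g l * ω)) {c s : ℝ}
    (hcs : c ^ 2 + s ^ 2 = 1) (hg'i : g' i = c • g i + s • g l) (hg'l : g' l = (-s) • g i + c • g l)
    (hg'o : ∀ m, m ≠ i → m ≠ l → g' m = g m) {κi κl : ℝ}
    (hwi : transferApply B (shadowFamily B L e₀ g i) = κi • shadowFamily B L e₀ g i)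
    (hwl : transferApply B (shadowFamily B L e₀ g l) = κl • shadowFamily B L e₀ g l) (hne : κi ≠ κl)
    (hnorm : l2 (shadowFamily B L e₀ g l) (shadowFamily B L e₀ g l) = l2 (shadowFamily B L e₀ g i) (shadowFamily B L e₀ g i))
    (hpos : 0 < l2 (shadowFamily B L e₀ g i) (shadowFamily B L e₀ g i)) {ε : ℝ} (hε : ε < min (c ^ 2) (s ^ 2)) :
    let w' : Fin k → (GaugeConfig 3 1 SU2 → ℝ) := shadowFamily B L e₀ g'
    LiftBasis B₁ k ω g' ∧
      ¬ ∃ (N : ℕ) (ψ : Fin N → (GaugeConfig 3 1 SU2 → ℝ)) (ev : Fin N → ℝ) (S : Finset (Fin N)),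
          (∀ j, IsPhys (ψ j)) ∧ (∀ j j', l2 (ψ j) (ψ j') = if j = j' then 1 else 0) ∧
          (∀ j, transferApply B (ψ j) = ev j • ψ j) ∧
          (∑ j ∈ Sᶜ, l2 (w' i) (ψ j) ^ 2 + l2 (w' i - ∑ j, l2 (w' i) (ψ j) • ψ j) (w' i - ∑ j, l2 (w' i) (ψ j) • ψ j) ≤
            ε * l2 (w' i) (w' i)) ∧
          (∑ j ∈ S, l2 (w' l) (ψ j) ^ 2 ≤ ε * l2 (w' l) (w' l)) := by
  intro w'
  refine ⟨liftBasis_of_rotated hbasis hil hdeg hcs hg'i hg'l hg'o, ?_⟩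
  have hg : ∀ m, IsPhys (g m) := hbasis.2.2.2.2.1
  have hw : ∀ m, IsPhys (shadowFamily B L e₀ g m) := fun m => by
    simp only [shadowFamily, shadowVec]
    exact isPhys_iterate_transferApply B (OpPlat.isPhys_ins he₀.1 (isPhys_comp_powLink L (hg m))) _
  obtain ⟨hi', hl'⟩ := shadowFamily_rotated B L he₀.1 hg hg'i hg'l
  have hε' : ε * (c ^ 2 + s ^ 2) < min (c ^ 2) (s ^ 2) := by rw [hcs, mul_one]; exact hε
  show ¬ ∃ (N : ℕ) (ψ : Fin N → (GaugeConfig 3 1 SU2 → ℝ)) (ev : Fin N → ℝ) (S : Finset (Fin N)), _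
  rw [show w' i = c • shadowFamily B L e₀ g i + s • shadowFamily B L e₀ g l from hi',
    show w' l = (-s) • shadowFamily B L e₀ g i + c • shadowFamily B L e₀ g l from hl']
  exact not_amplitudeClause_of_rotated_pair B (hw i) (hw l) hwi hwl hne hnorm hpos hε'

end Summit.QuantumFields.YangMills.Theorems.FemtoTransferGap.PolyakovLift.Negative
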